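import Summits.AtomisticToContinuum.HydrodynamicLimit.Theses.AdiabaticParcels

/-!
# Line `pressure-inversion` for the crux `AdiabaticClosure` (stmt-AtomisticToContinuum-17362)

Route `route-AtomisticToContinuum-AdiabaticParcels`, crux decl
`Summit.AtomisticToContinuum.HydrodynamicLimit.Theses.AdiabaticParcels.AdiabaticClosure`
(packing-guarded; GIVEN the kinematic limits — density and momentum fields at every `s ∈ [0,T)` —
the empirical ENERGY field converges at every `t ∈ [0,T)` to `∫ χ E_t`).
Strategist `planner-cstrat-stmt-AtomisticToContinuum-17362-r1-0`, 2026-08-17 (redirect r1). A SECOND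
line beside `Lines/birth.lean` (K, C, D: energy-law duality). Nothing here restates the crux or the
Statement.

* THE LEVER — PRESSURE INVERSION THROUGH THE MOMENTUM LAW. Under the crux's hypothesis the momentum
  field `ρu` is KNOWN at every time, so the exact microscopic momentum balance pins the limiting
  pressure GRADIENT: for every smooth space–time vector test field `F`,
  `∫₀ᵗ ⟨P_N(s), ∇F_s⟩ ds → ∫₀ᵗ∫ p_E div F_s` (P_N = peculiar kinetic stress + collisional transfer,
  `p_E = ρθZ(ρσ³)` the Euler pressure). Hard spheres are ATHERMAL: all internal energy is kinetic and
  `p = (2/3) Z(ρσ³) ε_int` is linear and strictly increasing in the internal energy density at given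
  density. Hence IF the peculiar stress is isotropic (stub I) and its collisional part has the contact
  value `(Z − 1)·(2/3)ε_int` (stub II), then `(2/3)Z ε_int,N` has, in the limit, the same distributional
  gradient as `p_E` at a.e. time — so it equals `p_E + c(t)`; energy conservation kills `c(t)`; the class
  `{Z div F} ⊕ ℝ` exhausts the smooth test functions (solve `div F = (ψ − c)/Z`, Poisson on `𝕋³`) — this
  gives TIME-AVERAGED convergence of the energy field; time-tightness of the tested energy (stub III, a
  BOUND on energy currents, no closure) upgrades it to every fixed `t` (stub IV, analysis).
* WHAT IT DODGES. The energy law is never closed: no kinetic heat flux (odd THIRD moments), no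
  collisional energy-transfer statistics — the inputs of `birth`'s K and C that sit inside
  `HighMomentumCutoffBarrierNarrow` (cubic convective current). Stubs I, II, IV use only currents
  BOUNDED BY THE ENERGY (quadratic stress), the barrier's own evasion (ii) [BraxmeierEvenOlla2014 §1];
  only stub III touches the cubic current, and only as tightness (it follows e.g. from the tree's open
  hypothesis `HighMomentumCutoff σ`). What it does NOT dodge: I and II are local equilibrium at the
  second-moment / pair-contact level along a deterministic non-equilibrium evolution at fixed `σ`
  (`BoltzmannHypothesisBarrierNarrow`: flux closure "equally unproved for deterministic hard spheres").
* OBJECTS (§0): tested momentum `⟨m_N, G⟩`, tested kinetic momentum flux `⟨Π_N, ∇F⟩`, the ISOTROPY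
  DEFECT (traceless peculiar kinetic stress, time-integrated), the COLLISIONAL MOMENTUM TRANSFER
  functional (defined as the remainder of the exact momentum balance, pathwise = the collision sum
  `∑ N⁻¹(F(qᵢ) − F(qⱼ))·Δvᵢ`), the CONTACT-STRESS DEFECT, ENERGY TIGHTNESS, and verbatim copies of the
  crux's hypothesis / conclusion (`KinematicLimits`, `EnergyLimits`, as in `birth`).
* Composition `AdiabaticClosure_of : I → II → III → IV → AdiabaticClosure` (sorry-free).
-/

noncomputable section

open MeasureTheory Filter Set
open scoped ENNReal Topology InnerProductSpace

namespace Summit.AtomisticToContinuum.HydrodynamicLimit.Cruxes.AdiabaticClosure.PressureInversion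

open Literature.MathematicalPhysics.KineticTheory
open Literature.Analysis.FunctionSpaces
open Summit.AtomisticToContinuum.HydrodynamicLimit.Theses
open Summit.AtomisticToContinuum.HydrodynamicLimit.Theses.AdiabaticParcels

/-! ## §0 Objects of the line -/

/-- Tested empirical **momentum** against a vector field `G`: `N⁻¹ ∑ᵢ ⟪vᵢ, G(qᵢ)⟫`. -/
def momentumPairing {n : ℕ} (z : Literature.Analysis.FluidPDE.Config n (Fin 3) T3) (G : T3 → V3) : ℝ :=
  ∫ y, ⟪y.2, G y.1⟫_ℝ ∂Literature.Analysis.FluidPDE.empiricalMeasure z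

/-- Tested empirical **kinetic momentum flux** against the Jacobian of a vector field `F`:
`N⁻¹ ∑ᵢ ∑_b vᵢ,b ⟪vᵢ, ∂_b F(qᵢ)⟫` (= `Π_kin : ∇F`). -/
def kineticStressPairing {n : ℕ} (z : Literature.Analysis.FluidPDE.Config n (Fin 3) T3)
    (F : T3 → V3) : ℝ :=
  ∫ y, ∑ b : Fin 3, y.2 b * ⟪y.2, Torus.partialDeriv b F y.1⟫_ℝ
    ∂Literature.Analysis.FluidPDE.empiricalMeasure z

/-- The **isotropy defect** `X_N(t, F)(z)`: the time-integrated TRACELESS peculiar kinetic stress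
tested against `∇F`, `∫₀ᵗ N⁻¹∑ᵢ [∑_b cᵢ,b ⟪cᵢ, ∂_b F_s(qᵢ)⟫ − ‖cᵢ‖²/3 · div F_s(qᵢ)] ds`,
`cᵢ = vᵢ − u(s, qᵢ)` the peculiar velocity about the kinematic limit field `u`. -/
def isotropyDefect (σ : ℝ) (u : ℝ → T3 → V3) {N : ℕ}
    (Φ : Literature.Analysis.FluidPDE.HardSphereFlow (Literature.Analysis.FluidPDE.Torus.geometry (Fin 3))
      (hsDiameter σ N) (N + 1))
    (F : ℝ → T3 → V3) (t : ℝ) (z : Literature.Analysis.FluidPDE.Config (N + 1) (Fin 3) T3) : ℝ :=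
  ∫ s in (0 : ℝ)..t,
    ∫ y, ((∑ b : Fin 3, (y.2 - u s y.1) b * ⟪y.2 - u s y.1, Torus.partialDeriv b (F s) y.1⟫_ℝ)
        - ‖y.2 - u s y.1‖ ^ 2 / 3 * Torus.divergence (F s) y.1)
      ∂Literature.Analysis.FluidPDE.empiricalMeasure (Φ.flow s z)

/-- The **collisional momentum transfer functional** `C_N(t, F)(z) = ⟨m_N(t), F_t⟩ − ⟨m_N(0), F_0⟩
− ∫₀ᵗ [⟨m_N(s), ∂ₛF_s⟩ + ⟨Π_N(s), ∇F_s⟩] ds` (time derivative one-sided within `[0,T)`): along a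
hard-sphere trajectory exactly the collision sum `∑ N⁻¹ (F(qᵢ) − F(qⱼ))·Δvᵢ` over `[0,t]` — the
tested collisional stress — defined as the remainder so no collision bookkeeping enters. -/
def collisionalMomentumTransfer (σ T : ℝ) {N : ℕ}
    (Φ : Literature.Analysis.FluidPDE.HardSphereFlow (Literature.Analysis.FluidPDE.Torus.geometry (Fin 3))
      (hsDiameter σ N) (N + 1))
    (F : ℝ → T3 → V3) (t : ℝ) (z : Literature.Analysis.FluidPDE.Config (N + 1) (Fin 3) T3) : ℝ :=
  momentumPairing (Φ.flow t z) (F t) - momentumPairing (Φ.flow 0 z) (F 0)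
    - ∫ s in (0 : ℝ)..t,
        (momentumPairing (Φ.flow s z) (Torus.timeDerivWithin (Ico 0 T) F s)
          + kineticStressPairing (Φ.flow s z) (F s))

/-- The **contact-stress defect** `Y_N(t, F)(z)`: the collisional momentum transfer minus its
local-equilibrium contact closure `∫₀ᵗ N⁻¹∑ᵢ (Z(ρσ³) − 1)(qᵢ) ‖cᵢ‖²/3 · div F_s(qᵢ) ds`
(`Z = hsCompressibility`; excess pressure `p_exc = (Z − 1)(2/3)ε_int`, `ε_int = ½∑‖cᵢ‖²`). -/
def contactStressDefect (σ T : ℝ) (ρ : ℝ → T3 → ℝ) (u : ℝ → T3 → V3) {N : ℕ}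
    (Φ : Literature.Analysis.FluidPDE.HardSphereFlow (Literature.Analysis.FluidPDE.Torus.geometry (Fin 3))
      (hsDiameter σ N) (N + 1))
    (F : ℝ → T3 → V3) (t : ℝ) (z : Literature.Analysis.FluidPDE.Config (N + 1) (Fin 3) T3) : ℝ :=
  collisionalMomentumTransfer σ T Φ F t z
    - ∫ s in (0 : ℝ)..t,
        ∫ y, (hsCompressibility (ρ s y.1 * σ ^ 3) - 1) * (‖y.2 - u s y.1‖ ^ 2 / 3) *
            Torus.divergence (F s) y.1
          ∂Literature.Analysis.FluidPDE.empiricalMeasure (Φ.flow s z)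

/-- **The kinematic limits** — verbatim the hypothesis of the crux (as in `birth`). -/
def KinematicLimits (σ : ℝ) (a₀ : T3 → ℝ) (u₀ : T3 → V3) (θ₀ : T3 → ℝ)
    (Φ : (N : ℕ) → Literature.Analysis.FluidPDE.HardSphereFlow
      (Literature.Analysis.FluidPDE.Torus.geometry (Fin 3)) (hsDiameter σ N) (N + 1))
    (ρ : ℝ → T3 → ℝ) (u : ℝ → T3 → V3) (T : ℝ) : Prop :=
  ∀ s ∈ Set.Ico 0 T,
    (∀ χ : T3 → ℝ, Continuous χ → ∀ δ : ℝ, 0 < δ →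
      Tendsto (fun N => localGibbsLaw σ a₀ u₀ θ₀ N (Φ N)
        {z | δ < |empiricalDensityField ((Φ N).flow s z) χ - ∫ x, χ x * ρ s x|}) atTop (𝓝 0)) ∧
    (∀ χ : T3 → ℝ, Continuous χ → ∀ δ : ℝ, 0 < δ →
      Tendsto (fun N => localGibbsLaw σ a₀ u₀ θ₀ N (Φ N)
        {z | δ < ‖empiricalMomentumField ((Φ N).flow s z) χ - ∫ x, (χ x * ρ s x) • u s x‖}) atTop (𝓝 0))

/-- **The energy limits** — verbatim the conclusion of the crux (as in `birth`). -/
def EnergyLimits (σ : ℝ) (a₀ : T3 → ℝ) (u₀ : T3 → V3) (θ₀ : T3 → ℝ)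
    (Φ : (N : ℕ) → Literature.Analysis.FluidPDE.HardSphereFlow
      (Literature.Analysis.FluidPDE.Torus.geometry (Fin 3)) (hsDiameter σ N) (N + 1))
    (ρ : ℝ → T3 → ℝ) (u : ℝ → T3 → V3) (θ : ℝ → T3 → ℝ) (T : ℝ) : Prop :=
  ∀ t ∈ Set.Ico 0 T, ∀ χ : T3 → ℝ, Continuous χ → ∀ δ : ℝ, 0 < δ →
    Tendsto (fun N => localGibbsLaw σ a₀ u₀ θ₀ N (Φ N)
      {z | δ < |empiricalEnergyField ((Φ N).flow t z) χ -
        ∫ x, χ x * totalEnergyDensity (ρ t x) (u t x) (θ t x)|}) atTop (𝓝 0)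

/-- **Isotropy closes**: for every space–time vector test field smooth on `[0,T) × 𝕋³` and every
`t ∈ [0,T)` the isotropy defect vanishes in probability. -/
def IsotropyCloses (σ : ℝ) (a₀ : T3 → ℝ) (u₀ : T3 → V3) (θ₀ : T3 → ℝ)
    (Φ : (N : ℕ) → Literature.Analysis.FluidPDE.HardSphereFlow
      (Literature.Analysis.FluidPDE.Torus.geometry (Fin 3)) (hsDiameter σ N) (N + 1))
    (u : ℝ → T3 → V3) (T : ℝ) : Prop :=
  ∀ F : ℝ → T3 → V3, Torus.IsSmoothSpaceTimeOn (Ico 0 T) F →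
    ∀ t ∈ Set.Ico 0 T, ∀ δ : ℝ, 0 < δ →
      Tendsto (fun N => localGibbsLaw σ a₀ u₀ θ₀ N (Φ N)
        {z | δ < |isotropyDefect σ u (Φ N) F t z|}) atTop (𝓝 0)

/-- **Contact stress closes**: for every smooth space–time vector test field and every `t ∈ [0,T)`
the contact-stress defect vanishes in probability. -/
def ContactStressCloses (σ : ℝ) (a₀ : T3 → ℝ) (u₀ : T3 → V3) (θ₀ : T3 → ℝ)
    (Φ : (N : ℕ) → Literature.Analysis.FluidPDE.HardSphereFlow
      (Literature.Analysis.FluidPDE.Torus.geometry (Fin 3)) (hsDiameter σ N) (N + 1))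
    (ρ : ℝ → T3 → ℝ) (u : ℝ → T3 → V3) (T : ℝ) : Prop :=
  ∀ F : ℝ → T3 → V3, Torus.IsSmoothSpaceTimeOn (Ico 0 T) F →
    ∀ t ∈ Set.Ico 0 T, ∀ δ : ℝ, 0 < δ →
      Tendsto (fun N => localGibbsLaw σ a₀ u₀ θ₀ N (Φ N)
        {z | δ < |contactStressDefect σ T ρ u (Φ N) F t z|}) atTop (𝓝 0)

/-- **Energy tightness in time**: the tested empirical energy is equicontinuous in time in
probability, uniformly in `N` — for `t ∈ [0,T)`, continuous `χ`, `δ, ε > 0` there are a window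
`h > 0` and `N₀` such that for `N ≥ N₀` and every `s ∈ [t, t + h]`, `s < T`, the probability that
`|⟨e_N(s), χ⟩ − ⟨e_N(t), χ⟩| > δ` is at most `ε` (a BOUND on the energy currents; no closure). -/
def EnergyTight (σ : ℝ) (a₀ : T3 → ℝ) (u₀ : T3 → V3) (θ₀ : T3 → ℝ)
    (Φ : (N : ℕ) → Literature.Analysis.FluidPDE.HardSphereFlow
      (Literature.Analysis.FluidPDE.Torus.geometry (Fin 3)) (hsDiameter σ N) (N + 1))
    (T : ℝ) : Prop :=
  ∀ t ∈ Set.Ico 0 T, ∀ χ : T3 → ℝ, Continuous χ → ∀ δ : ℝ, 0 < δ → ∀ ε : ℝ, 0 < ε →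
    ∃ h : ℝ, 0 < h ∧ ∃ N₀ : ℕ, ∀ N : ℕ, N₀ ≤ N → ∀ s ∈ Set.Icc t (t + h), s < T →
      localGibbsLaw σ a₀ u₀ θ₀ N (Φ N)
          {z | δ < |empiricalEnergyField ((Φ N).flow s z) χ - empiricalEnergyField ((Φ N).flow t z) χ|}
        ≤ ENNReal.ofReal ε

/-! ## §1 Stub signatures (all in the crux's own frame) -/

/-- **I — isotropy of the peculiar kinetic stress (XL; second moments, one-body).** -/
def Sig.stub_isotropy : Prop :=
  ∃ ηI : ℝ, 0 < ηI ∧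
    ∀ (a₀ θ₀ : T3 → ℝ) (u₀ : T3 → V3), Continuous a₀ → Continuous θ₀ → Continuous u₀ →
      (∀ x, 0 < a₀ x) → (∀ x, 0 < θ₀ x) →
      ∃ σ₀ : ℝ, 0 < σ₀ ∧ ∀ σ : ℝ, 0 < σ → σ < σ₀ →
        ∀ (T : ℝ) (ρ θ : ℝ → T3 → ℝ) (u : ℝ → T3 → V3), IsHardSphereEulerSolution σ T ρ u θ →
          (∀ t ∈ Set.Ico 0 T, ∀ x, ρ t x * σ ^ 3 < ηI) →
          ∀ Φ : (N : ℕ) → Literature.Analysis.FluidPDE.HardSphereFlow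
              (Literature.Analysis.FluidPDE.Torus.geometry (Fin 3)) (hsDiameter σ N) (N + 1),
            (∀ N, IsProbabilityMeasure (localGibbsLaw σ a₀ u₀ θ₀ N (Φ N))) →
            TendstoHydroFieldsAt (fun N => localGibbsLaw σ a₀ u₀ θ₀ N (Φ N)) Φ ρ u θ 0 →
            KinematicLimits σ a₀ u₀ θ₀ Φ ρ u T →
              IsotropyCloses σ a₀ u₀ θ₀ Φ u T

/-- **II — contact value of the collisional stress (XL; pair level, contact statistics).** -/
def Sig.stub_contactStress : Prop :=
  ∃ ηC : ℝ, 0 < ηC ∧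
    ∀ (a₀ θ₀ : T3 → ℝ) (u₀ : T3 → V3), Continuous a₀ → Continuous θ₀ → Continuous u₀ →
      (∀ x, 0 < a₀ x) → (∀ x, 0 < θ₀ x) →
      ∃ σ₀ : ℝ, 0 < σ₀ ∧ ∀ σ : ℝ, 0 < σ → σ < σ₀ →
        ∀ (T : ℝ) (ρ θ : ℝ → T3 → ℝ) (u : ℝ → T3 → V3), IsHardSphereEulerSolution σ T ρ u θ →
          (∀ t ∈ Set.Ico 0 T, ∀ x, ρ t x * σ ^ 3 < ηC) →
          ∀ Φ : (N : ℕ) → Literature.Analysis.FluidPDE.HardSphereFlow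
              (Literature.Analysis.FluidPDE.Torus.geometry (Fin 3)) (hsDiameter σ N) (N + 1),
            (∀ N, IsProbabilityMeasure (localGibbsLaw σ a₀ u₀ θ₀ N (Φ N))) →
            TendstoHydroFieldsAt (fun N => localGibbsLaw σ a₀ u₀ θ₀ N (Φ N)) Φ ρ u θ 0 →
            KinematicLimits σ a₀ u₀ θ₀ Φ ρ u T →
              ContactStressCloses σ a₀ u₀ θ₀ Φ ρ u T

/-- **III — energy tightness in time (L–XL; a bound on the cubic energy current, no closure;
follows e.g. from the tree's open hypothesis `HighMomentumCutoff σ` plus a collision-transfer bound).** -/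
def Sig.stub_energyTight : Prop :=
  ∃ ηT : ℝ, 0 < ηT ∧
    ∀ (a₀ θ₀ : T3 → ℝ) (u₀ : T3 → V3), Continuous a₀ → Continuous θ₀ → Continuous u₀ →
      (∀ x, 0 < a₀ x) → (∀ x, 0 < θ₀ x) →
      ∃ σ₀ : ℝ, 0 < σ₀ ∧ ∀ σ : ℝ, 0 < σ → σ < σ₀ →
        ∀ (T : ℝ) (ρ θ : ℝ → T3 → ℝ) (u : ℝ → T3 → V3), IsHardSphereEulerSolution σ T ρ u θ →
          (∀ t ∈ Set.Ico 0 T, ∀ x, ρ t x * σ ^ 3 < ηT) →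
          ∀ Φ : (N : ℕ) → Literature.Analysis.FluidPDE.HardSphereFlow
              (Literature.Analysis.FluidPDE.Torus.geometry (Fin 3)) (hsDiameter σ N) (N + 1),
            (∀ N, IsProbabilityMeasure (localGibbsLaw σ a₀ u₀ θ₀ N (Φ N))) →
            TendstoHydroFieldsAt (fun N => localGibbsLaw σ a₀ u₀ θ₀ N (Φ N)) Φ ρ u θ 0 →
            KinematicLimits σ a₀ u₀ θ₀ Φ ρ u T →
              EnergyTight σ a₀ u₀ θ₀ Φ T

/-- **IV — pressure inversion (M–L; analysis, provable now in principle).** In the crux's frame,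
GIVEN the kinematic limits: isotropy + contact stress + energy tightness force the energy field
(exact momentum balance ⇒ `∇((2/3)Z ε_int − p_E) = 0` in the limit; monotone athermal EOS;
energy conservation fixes the constant; `{Z div F} ⊕ ℝ = C^∞`; tightness gives fixed times). -/
def Sig.stub_pressureInversion : Prop :=
  ∃ ηP : ℝ, 0 < ηP ∧
    ∀ (a₀ θ₀ : T3 → ℝ) (u₀ : T3 → V3), Continuous a₀ → Continuous θ₀ → Continuous u₀ →
      (∀ x, 0 < a₀ x) → (∀ x, 0 < θ₀ x) →
      ∃ σ₀ : ℝ, 0 < σ₀ ∧ ∀ σ : ℝ, 0 < σ → σ < σ₀ →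
        ∀ (T : ℝ) (ρ θ : ℝ → T3 → ℝ) (u : ℝ → T3 → V3), IsHardSphereEulerSolution σ T ρ u θ →
          (∀ t ∈ Set.Ico 0 T, ∀ x, ρ t x * σ ^ 3 < ηP) →
          ∀ Φ : (N : ℕ) → Literature.Analysis.FluidPDE.HardSphereFlow
              (Literature.Analysis.FluidPDE.Torus.geometry (Fin 3)) (hsDiameter σ N) (N + 1),
            (∀ N, IsProbabilityMeasure (localGibbsLaw σ a₀ u₀ θ₀ N (Φ N))) →
            TendstoHydroFieldsAt (fun N => localGibbsLaw σ a₀ u₀ θ₀ N (Φ N)) Φ ρ u θ 0 →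
            KinematicLimits σ a₀ u₀ θ₀ Φ ρ u T →
            IsotropyCloses σ a₀ u₀ θ₀ Φ u T → ContactStressCloses σ a₀ u₀ θ₀ Φ ρ u T →
            EnergyTight σ a₀ u₀ θ₀ Φ T →
              EnergyLimits σ a₀ u₀ θ₀ Φ ρ u θ T

/-! ## §2 Stubs (registered; `sorry` only inside them) — hardest: `stub_isotropy` / `stub_contactStress` -/

/-- **I (XL).** Traceless peculiar kinetic stress vanishes at Euler order (time-integrated, tested). -/
theorem stub_isotropy : Sig.stub_isotropy := by
  sorry

/-- **II (XL).** Collisional stress at its contact value `(Z − 1)(2/3)ε_int 𝟙`. -/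
theorem stub_contactStress : Sig.stub_contactStress := by
  sorry

/-- **III (L–XL).** Tested empirical energy is equicontinuous in time in probability. -/
theorem stub_energyTight : Sig.stub_energyTight := by
  sorry

/-- **IV (M–L).** Pressure inversion: I ∧ II ∧ III (given the kinematics) force the energy field. -/
theorem stub_pressureInversion : Sig.stub_pressureInversion := by
  sorry

/-! ## §3 Composition (sorry-free) -/

/-- **The line closes the crux modulo its stubs**: `AdiabaticClosure` BY NAME from I, II, III, IV —
common packing threshold `min (min ηI ηC) (min ηT ηP)`, density threshold likewise, the guard pushed
to each, the kinematic limits fed to I–IV, the three closures fed to the inversion IV. -/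
theorem AdiabaticClosure_of (hI : Sig.stub_isotropy) (hC : Sig.stub_contactStress)
    (hT : Sig.stub_energyTight) (hP : Sig.stub_pressureInversion) :
    AdiabaticParcels.AdiabaticClosure := by
  obtain ⟨ηI, hηI, HI⟩ := hI
  obtain ⟨ηC, hηC, HC⟩ := hC
  obtain ⟨ηT, hηT, HT⟩ := hT
  obtain ⟨ηP, hηP, HP⟩ := hP
  refine ⟨min (min ηI ηC) (min ηT ηP), lt_min (lt_min hηI hηC) (lt_min hηT hηP), ?_⟩
  intro a₀ θ₀ u₀ ha hθ hu ha0 hθ0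
  obtain ⟨σI, hσI, GI⟩ := HI a₀ θ₀ u₀ ha hθ hu ha0 hθ0
  obtain ⟨σC, hσC, GC⟩ := HC a₀ θ₀ u₀ ha hθ hu ha0 hθ0
  obtain ⟨σT, hσT, GT⟩ := HT a₀ θ₀ u₀ ha hθ hu ha0 hθ0
  obtain ⟨σP, hσP, GP⟩ := HP a₀ θ₀ u₀ ha hθ hu ha0 hθ0
  refine ⟨min (min σI σC) (min σT σP), lt_min (lt_min hσI hσC) (lt_min hσT hσP), ?_⟩
  intro σ hσ hσlt T ρ θ u hsol hG Φ hPm h0 hkin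
  have hσI' : σ < σI := lt_of_lt_of_le hσlt ((min_le_left _ _).trans (min_le_left _ _))
  have hσC' : σ < σC := lt_of_lt_of_le hσlt ((min_le_left _ _).trans (min_le_right _ _))
  have hσT' : σ < σT := lt_of_lt_of_le hσlt ((min_le_right _ _).trans (min_le_left _ _))
  have hσP' : σ < σP := lt_of_lt_of_le hσlt ((min_le_right _ _).trans (min_le_right _ _))
  have hGI : ∀ s ∈ Set.Ico 0 T, ∀ x, ρ s x * σ ^ 3 < ηI :=
    fun s hs x => lt_of_lt_of_le (hG s hs x) ((min_le_left _ _).trans (min_le_left _ _))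
  have hGC : ∀ s ∈ Set.Ico 0 T, ∀ x, ρ s x * σ ^ 3 < ηC :=
    fun s hs x => lt_of_lt_of_le (hG s hs x) ((min_le_left _ _).trans (min_le_right _ _))
  have hGT : ∀ s ∈ Set.Ico 0 T, ∀ x, ρ s x * σ ^ 3 < ηT :=
    fun s hs x => lt_of_lt_of_le (hG s hs x) ((min_le_right _ _).trans (min_le_left _ _))
  have hGP : ∀ s ∈ Set.Ico 0 T, ∀ x, ρ s x * σ ^ 3 < ηP :=
    fun s hs x => lt_of_lt_of_le (hG s hs x) ((min_le_right _ _).trans (min_le_right _ _))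
  -- I: isotropy of the peculiar kinetic stress
  have hIso : IsotropyCloses σ a₀ u₀ θ₀ Φ u T := GI σ hσ hσI' T ρ θ u hsol hGI Φ hPm h0 hkin
  -- II: contact value of the collisional stress
  have hCon : ContactStressCloses σ a₀ u₀ θ₀ Φ ρ u T := GC σ hσ hσC' T ρ θ u hsol hGC Φ hPm h0 hkin
  -- III: energy tightness in time
  have hTi : EnergyTight σ a₀ u₀ θ₀ Φ T := GT σ hσ hσT' T ρ θ u hsol hGT Φ hPm h0 hkin
  -- IV: pressure inversion forces the energy field
  exact GP σ hσ hσP' T ρ θ u hsol hGP Φ hPm h0 hkin hIso hCon hTi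

/-- The skeleton instantiated: the crux modulo the four registered stubs. -/
theorem AdiabaticClosure_skeleton : AdiabaticParcels.AdiabaticClosure :=
  AdiabaticClosure_of stub_isotropy stub_contactStress stub_energyTight stub_pressureInversion

#print axioms AdiabaticClosure_of

end Summit.AtomisticToContinuum.HydrodynamicLimit.Cruxes.AdiabaticClosure.PressureInversion

end
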